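import Summits.BirchSwinnertonDyer.BirchSwinnertonDyer.Theorems.ManinLocalTwoThreeKatoShiftTwoPrimeClassPlus
import Summits.BirchSwinnertonDyer.BirchSwinnertonDyer.Theorems.ManinLocalTwoThreeMazurManinConstantOddPrimes
import Summits.BirchSwinnertonDyer.BirchSwinnertonDyer.Theorems.ManinLocalTwoThreeTameUnitTwistFourier
import Summits.BirchSwinnertonDyer.Rank1Residual.ManinAdditive.Gamma1LatticeBalancedCuspDifferences
import Literature.NumberTheory.EllipticCurves.SkinnerUrban2014.PAdicUnitPeriodRatioProofs
import Literature.NumberTheory.EllipticCurves.SkinnerUrban2014.PAdicUnitImaginaryPeriodRatioProofs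
import Literature.NumberTheory.EllipticCurves.Rank1Residual.PeriodUnitProofs
import Literature.NumberTheory.EllipticCurves.KatoAdditiveTwistedValueNeronIntegrality
import Literature.NumberTheory.EllipticCurves.ModularCurveRealPeriodProofs
import Literature.NumberTheory.EllipticCurves.ModularFormsGamma0Genus
import Literature.NumberTheory.EllipticCurves.PAdicLFunctionProofs
import HarnessLib

/-!
# Kato's fact F″ (`kato_neron_isIntegral_twistedSymbolSum_of_additive_five_le`) DISCHARGED — by the
# elementary reversal: the Manin constant is prime to every `p ≥ 3` (tree theorem), so twisted symbol sums
# at conductors prime to the level are Néron-integral at every prime `p ≥ 5` with `E[p]` irreducible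

Route `EdixhovenFibreFiveSeven` (cell `pub/bsd-wall`, seat `bsd-line-edix-p1` g43), `--supports` the PUB bundle
`KatoNeronAndCremonaFacts` (stmt-BirchSwinnertonDyer-23789), whose first conjunct is the Literature named fact
F″ = `Literature.NumberTheory.EllipticCurves.kato_neron_isIntegral_twistedSymbolSum_of_additive_five_le`
(a DERIVED READING of Kato 2004 (8.1.3)/Thm 9.7/Thm 6.6 + Kim–Nakamura 2020 §2 + Kosters–Pannekoek 2017: for
`V/ℚ` globally minimal with newform `f` at level `N`, additive at `p ≥ 5` with `E[p]` irreducible, and a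
primitive `χ ≠ 1` of conductor `m` prime to `pN`: the Euler-depleted twisted symbol sum
`∏_{ℓ ∥ N}(ℓ − a_ℓχ(ℓ))(ℓ − a_ℓχ(ℓ)⁻¹) · Σ_a χ(a){∞, a/m}_f = r · Ω^±_f` has `s·ϖ·r` an algebraic integer
for some `p ∤ s`, where `ϖ · Ω^±(V) = Ω^±_f`).  Until now F″ was cite-only («size XL: Kato's explicit
reciprocity law»), and it was the INPUT of the conditional closers of K★ (p581141), TDS57, KP57, TDS11.

THE REVERSAL.  Since K★'s line `cdt_thm1` landed the Unbounded-Denominators chain, the tree PROVES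
`p ∤ c₀` for every `p ≥ 3` and every lattice-optimal `X₀(N)`-datum at every level
(`Theorems.not_dvd_maninConstant_of_three_le`, p828097).  With that input F″ is ELEMENTARY and needs
neither the additivity of `p`, nor the Kosters–Pannekoek clause, nor `p ∤ ord χ`, nor primitivity:

1. `{∞, a/m}_f − {∞, 0}_f ∈ Λ_f` for every `a` when `gcd(m, N) = 1` — the cusp `a/m` is `Γ₀(N)`-equivalent
   to `0` (Manin's relation at `r = 0`, LEMMA A `Gamma1Lattice.exists_gamma0_modularSymbol_div`);
2. for `χ ≠ 1` even, `Σ_a χ(a){∞, a/m}_f = Σ_a χ(a)·re(…)` (`ManinLocalTwoThree.twistedSymbolSum_eq_sum_re_of_even`)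
   and `re Λ_f = ℤ·Ω⁺_f/2`; for `χ` odd, `= i·Σ_a χ(a)·im(…)` and `im Λ_f = ℤ·Ω⁻_f/2`; so the twisted sum is
   `k · Ω^±_f/2` (times `i` in the odd case) with `k ∈ ℤ[χ]` an algebraic integer, and `2r = (Euler)·k`;
3. `Ω^±(V) = u · Ω^±_f` with `‖u‖_p = 1` for `p` odd, `E[p]` irreducible and `p ∤ c₀`
   (`SkinnerUrban2014.exists_unit_mul_plusPeriod_of_irreducible` / `…minusPeriod…`: optimal datum by Edixhoven's
   integrality, prime-to-`p` isogeny under irreducibility, Néron scaling); hence `ord_p ϖ = 0` and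
   `s := 2·den(ϖ)` works: `s ϖ r = num(ϖ) · (Euler) · k`.

* `kato_neron_isIntegral_twistedSymbolSum_of_additive_five_le_holds : F″`.

HONEST STATUS.  The discharge rests, through `not_dvd_maninConstant_of_three_le`, on the in-tree Unbounded
Denominators term (`calegariDimitrovTang2025_unboundedDenominators_holds`): wording of record «kernel-closed,
UDC-dependent, audit (P†) pending».  As typed, F″ is weaker than Kato's theorem (it is a statement about
`Λ_f`-periods transferred to Néron periods; Kato's Euler-system integrality is not formalised here).  Item 23789
stays OPEN on its second conjunct (Cremona's range `|c₀| = 1`, `N ≤ 5·10⁵`).  BSD is proved for no curve;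
Manin's conjecture is not announced.
-/

set_option autoImplicit false
-- the Theorems namespace of this sub repeats the summit name by design (D-0017 nested layout)
set_option linter.dupNamespace false

noncomputable section

open scoped Classical MatrixGroups ModularForm

open CongruenceSubgroup Complex WeierstrassCurve Literature.NumberTheory.EllipticCurves
  Literature.NumberTheory.EllipticCurves.ModularForms

namespace Summit.BirchSwinnertonDyer.BirchSwinnertonDyer.Theorems

namespace KatoNeronTwistedSymbolSum

/-! ### §1 Cusps of denominator prime to the level -/

/-- **`{∞, a/m}_f − {∞, 0}_f ∈ Λ_f` for every `a : ℤ/m` when `gcd(m, N) = 1`** (reduce the fraction; its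
denominator divides `m`, so is prime to `N`, and the cusp is `Γ₀(N)`-equivalent to `0`: Manin's relation at
`r = 0`, LEMMA A `Gamma1Lattice.exists_gamma0_modularSymbol_div`). [cite: Manin1972, §1.6 and Thm. 1.9] -/
theorem modularSymbol_val_div_sub_zero_mem_periodLattice {N : ℕ} [NeZero N] (f : CuspForm (Gamma0 N) 2)
    {m : ℕ} (hNm : IsCoprime (N : ℤ) m) (a : ZMod m) :
    modularSymbol f ((a.val : ℚ) / m) - modularSymbol f 0 ∈ periodLattice f := by
  set r : ℚ := (a.val : ℚ) / m with hr
  have hden0 : (r.den : ℤ) ≠ 0 := by exact_mod_cast r.den_ne_zero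
  have hcop : IsCoprime r.num (r.den : ℤ) := Int.isCoprime_iff_gcd_eq_one.mpr r.reduced
  have hdvd : (r.den : ℤ) ∣ (m : ℤ) := by
    have h := Rat.den_dvd (a.val : ℤ) (m : ℤ)
    have e : ((a.val : ℤ) : ℚ) / ((m : ℤ) : ℚ) = r := by rw [hr]; push_cast; rfl
    rwa [← Rat.intCast_div_eq_divInt, e] at h
  have hNd : IsCoprime (N : ℤ) (r.den : ℤ) := by
    obtain ⟨c, hc⟩ := hdvd
    rw [hc] at hNm
    exact hNm.of_mul_right_left
  obtain ⟨δ, -, -, hδ⟩ :=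
    Summit.BirchSwinnertonDyer.Rank1Residual.ManinAdditive.Gamma1Lattice.exists_gamma0_modularSymbol_div f
      hden0 hcop hNd
  have e : ((r.num : ℤ) : ℚ) / ((r.den : ℤ) : ℚ) = r := by push_cast; exact Rat.num_div_den r
  rw [e] at hδ
  rw [hδ, add_sub_cancel_right]
  exact cuspSymbol_mem_periodLattice f δ

/-! ### §2 Algebraic integers -/

/-- The inverse of a value of a Dirichlet character is an algebraic integer (`(χ a)⁻¹ = χ⁻¹ a`). [folklore] -/
theorem isIntegral_dirichletCharacter_apply_inv {m : ℕ} [NeZero m] (χ : DirichletCharacter ℂ m) (a : ZMod m) :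
    IsIntegral ℤ (χ a)⁻¹ := by
  rw [← MulChar.inv_apply_eq_inv']
  exact ManinLocalTwoThree.DirichletCharacter.isIntegral_apply χ⁻¹ a

/-- The Euler-depletion factor `∏_{ℓ ∈ S}(ℓ − a_ℓ χ(ℓ))(ℓ − a_ℓ χ(ℓ)⁻¹)` of F″ is an algebraic integer
(`a_ℓ ∈ ℤ`, character values are roots of unity or `0`). [folklore] -/
theorem isIntegral_eulerDepletion {m : ℕ} [NeZero m] (χ : DirichletCharacter ℂ m) (a : ℕ → ℤ)
    (S : Finset ℕ) :
    IsIntegral ℤ (∏ ℓ ∈ S, (((ℓ : ℂ) - (a ℓ : ℂ) * χ (ℓ : ZMod m)) *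
      ((ℓ : ℂ) - (a ℓ : ℂ) * (χ (ℓ : ZMod m))⁻¹))) := by
  refine IsIntegral.prod _ fun ℓ _ ↦ IsIntegral.mul ?_ ?_
  · exact (isIntegral_algebraMap (R := ℤ) (x := (ℓ : ℤ))).sub
      ((isIntegral_algebraMap (R := ℤ) (x := a ℓ)).mul (ManinLocalTwoThree.DirichletCharacter.isIntegral_apply χ _))
  · exact (isIntegral_algebraMap (R := ℤ) (x := (ℓ : ℤ))).sub
      ((isIntegral_algebraMap (R := ℤ) (x := a ℓ)).mul (isIntegral_dirichletCharacter_apply_inv χ _))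

/-! ### §3 The twisted symbol sum in the period lattice of the newform -/

/-- **Even characters.** For `f ∈ S₂(Γ₀(N))` a normalised newform with rational coefficients, `m` prime to `N`
and `χ ≠ 1` an EVEN character mod `m`: `Σ_a χ(a){∞, a/m}_f = k · Ω⁺_f/2` with `k` an algebraic integer
(`Σ_a χ(a) = 0` removes `{∞,0}`; `a ↦ −a` and `{∞,−r} = conj{∞,r}` leave the real parts; each
`{∞,a/m} − {∞,0} ∈ Λ_f` has real part in `re Λ_f = ℤ·Ω⁺_f/2`). [cite: MazurTateTeitelbaum1986, §I.8]
[cite: CremonaAlgorithms1997, §2.8] -/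
theorem exists_isIntegral_twistedSymbolSum_eq_of_even {N : ℕ} [NeZero N] (f : CuspForm (Gamma0 N) 2)
    (hf : IsNewform0 f) (hQ : coeffField f = ⊥) {m : ℕ} [NeZero m] (hNm : IsCoprime (N : ℤ) m)
    (χ : DirichletCharacter ℂ m) (hχ : χ.Even) (hχ1 : χ ≠ 1) :
    ∃ k : ℂ, IsIntegral ℤ k ∧ twistedSymbolSum f χ = k * ((plusPeriod f / 2 : ℝ) : ℂ) := by
  have hreal : ∀ n, (cuspCoeff f n).im = 0 := cuspCoeff_im_eq_zero_of_coeffField_eq_bot hQ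
  have hΩ : 0 < plusPeriod f := IsNewform0.plusPeriod_pos_holds hf hQ
  have hre : realPeriods f = AddSubgroup.zmultiples (plusPeriod f / 2) :=
    realPeriods_eq_zmultiples_of_plusPeriod_pos f hΩ
  -- each `re({∞,a/m} − {∞,0})` is an integer multiple of `Ω⁺_f/2`
  have hmem : ∀ x : ZMod m, ∃ n : ℤ,
      (modularSymbol f (((x.val : ℕ) : ℚ) / m) - modularSymbol f 0).re = n * (plusPeriod f / 2) := by
    intro x
    have h1 : (modularSymbol f (((x.val : ℕ) : ℚ) / m) - modularSymbol f 0).re ∈ realPeriods f :=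
      AddSubgroup.mem_map.mpr ⟨_, modularSymbol_val_div_sub_zero_mem_periodLattice f hNm x, rfl⟩
    rw [hre, AddSubgroup.mem_zmultiples_iff] at h1
    obtain ⟨n, hn⟩ := h1
    exact ⟨n, by rw [← hn, zsmul_eq_mul]⟩
  choose n hn using hmem
  refine ⟨∑ x : ZMod m, χ x * (n x : ℂ), IsIntegral.sum _ fun x _ ↦
    (ManinLocalTwoThree.DirichletCharacter.isIntegral_apply χ x).mul (isIntegral_algebraMap (R := ℤ) (x := n x)), ?_⟩
  rw [ManinLocalTwoThree.twistedSymbolSum_eq_sum_re_of_even f (NeZero.ne m) hreal χ hχ hχ1, Finset.sum_mul]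
  refine Finset.sum_congr rfl fun x _ ↦ ?_
  rw [hn x]
  push_cast
  ring

/-- **Odd characters.** Same setting, `χ` ODD: `Σ_a χ(a){∞, a/m}_f = i · k · Ω⁻_f/2` with `k` an algebraic
integer (`im Λ_f = ℤ·Ω⁻_f/2`). [cite: MazurTateTeitelbaum1986, §I.8] [cite: CremonaAlgorithms1997, §2.8] -/
theorem exists_isIntegral_twistedSymbolSum_eq_of_odd {N : ℕ} [NeZero N] (f : CuspForm (Gamma0 N) 2)
    (hf : IsNewform0 f) (hQ : coeffField f = ⊥) {m : ℕ} [NeZero m] (hNm : IsCoprime (N : ℤ) m)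
    (χ : DirichletCharacter ℂ m) (hχ : χ.Odd) :
    ∃ k : ℂ, IsIntegral ℤ k ∧ twistedSymbolSum f χ = I * (k * ((minusPeriod f / 2 : ℝ) : ℂ)) := by
  have hreal : ∀ n, (cuspCoeff f n).im = 0 := cuspCoeff_im_eq_zero_of_coeffField_eq_bot hQ
  have hΩ : 0 < minusPeriod f := IsNewform0.minusPeriod_pos_holds hf hQ
  have him : imagPeriods f = AddSubgroup.zmultiples (minusPeriod f / 2) :=
    SkinnerUrban2014.imagPeriods_eq_zmultiples_of_minusPeriod_pos f hΩ
  have hmem : ∀ x : ZMod m, ∃ n : ℤ,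
      (modularSymbol f (((x.val : ℕ) : ℚ) / m) - modularSymbol f 0).im = n * (minusPeriod f / 2) := by
    intro x
    have h1 : (modularSymbol f (((x.val : ℕ) : ℚ) / m) - modularSymbol f 0).im ∈ imagPeriods f :=
      AddSubgroup.mem_map.mpr ⟨_, modularSymbol_val_div_sub_zero_mem_periodLattice f hNm x, rfl⟩
    rw [him, AddSubgroup.mem_zmultiples_iff] at h1
    obtain ⟨n, hn⟩ := h1
    exact ⟨n, by rw [← hn, zsmul_eq_mul]⟩
  choose n hn using hmem
  refine ⟨∑ x : ZMod m, χ x * (n x : ℂ), IsIntegral.sum _ fun x _ ↦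
    (ManinLocalTwoThree.DirichletCharacter.isIntegral_apply χ x).mul (isIntegral_algebraMap (R := ℤ) (x := n x)), ?_⟩
  rw [ManinLocalTwoThree.twistedSymbolSum_eq_I_mul_sum f (NeZero.ne m) hreal χ hχ, Finset.sum_mul]
  congr 1
  refine Finset.sum_congr rfl fun x _ ↦ ?_
  rw [hn x]
  push_cast
  ring

/-! ### §4 `p`-adic bookkeeping -/

/-- A rational of `p`-adic valuation `0` has denominator prime to `p`. [folklore] -/
theorem not_dvd_den_of_padicValRat_eq_zero {p : ℕ} [hp : Fact p.Prime] {q : ℚ}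
    (hq : padicValRat p q = 0) : ¬ p ∣ q.den := by
  intro hd
  have hnum : ¬ (p : ℤ) ∣ q.num := by
    intro hn
    have h1 : p ∣ q.num.natAbs := Int.natCast_dvd.mp hn
    have := Nat.eq_one_of_dvd_coprimes q.reduced h1 hd
    exact hp.out.one_lt.ne' this
  have h0 : padicValInt p q.num = 0 := padicValInt.eq_zero_of_not_dvd hnum
  have h1 : 1 ≤ padicValNat p q.den := one_le_padicValNat_of_dvd q.den_ne_zero hd
  simp only [padicValRat, h0] at hq
  omega

/-- The period ratio on the MINUS side is a `p`-adic unit: if `|Ω⁻(W)| = u·Ω⁻_f` with `‖u‖_p = 1` and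
`ϖ·|Ω⁻(W)| = Ω⁻_f`, then `ord_p ϖ = 0` (`ϖ = u⁻¹` as `|Ω⁻(W)| > 0`). The plus side is the tree's
`Rank1Residual.padicValRat_periodRatio_eq_zero_of_eq_unit_mul`. [cite: GreenbergVatsal2000, §3, Remark 3.4] -/
theorem padicValRat_minusPeriodRatio_eq_zero_of_eq_unit_mul (W : WeierstrassCurve ℚ) [W.IsElliptic]
    (p : ℕ) [Fact p.Prime] {N : ℕ} (f : CuspForm (Gamma0 N) 2) {u : ℚ} (hu : ‖(u : ℚ_[p])‖ = 1)
    (hΩ : W.imaginaryPeriodRat = u * minusPeriod f) (ϖ : ℚ)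
    (hϖ : (ϖ : ℝ) * W.imaginaryPeriodRat = minusPeriod f) : padicValRat p ϖ = 0 := by
  have hΩpos : 0 < W.imaginaryPeriodRat := W.imaginaryPeriodRat_pos
  have hminus : minusPeriod f ≠ 0 := by
    intro h0
    rw [h0, mul_zero] at hΩ
    exact hΩpos.ne' hΩ
  have hprod : ((ϖ * u : ℚ) : ℝ) = 1 := by
    have h1 : ((ϖ : ℝ) * u) * minusPeriod f = 1 * minusPeriod f := by
      rw [one_mul, mul_assoc, ← hΩ, hϖ]
    push_cast
    exact mul_right_cancel₀ hminus h1
  have hprodQ : ϖ * u = 1 := by exact_mod_cast hprod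
  have hu0 : u ≠ 0 := right_ne_zero_of_mul_eq_one hprodQ
  have hϖ0 : ϖ ≠ 0 := left_ne_zero_of_mul_eq_one hprodQ
  have hval : padicValRat p (ϖ * u) = 0 := by rw [hprodQ, padicValRat.one]
  rw [padicValRat.mul hϖ0 hu0, Rank1Residual.padicValRat_eq_zero_of_norm_ratCast_eq_one hu, add_zero] at hval
  exact hval

/-- From `ord_p ϖ = 0` and `2r` an algebraic integer: `s := 2·den(ϖ)` has `p ∤ s` (`p` odd) and
`s·ϖ·r = num(ϖ)·(2r)` is an algebraic integer. [folklore] -/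
theorem exists_not_dvd_isIntegral_mul {p : ℕ} [hp : Fact p.Prime] (hp2 : p ≠ 2) {ϖ : ℚ}
    (hϖ : padicValRat p ϖ = 0) {r t : ℂ} (ht : IsIntegral ℤ t) (hr : 2 * r = t) :
    ∃ s : ℕ, ¬ p ∣ s ∧ IsIntegral ℤ ((s : ℂ) * ϖ * r) := by
  refine ⟨2 * ϖ.den, ?_, ?_⟩
  · intro h
    rcases (Nat.Prime.dvd_mul hp.out).mp h with h2 | hden
    · exact hp2 ((Nat.prime_dvd_prime_iff_eq hp.out Nat.prime_two).mp h2)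
    · exact not_dvd_den_of_padicValRat_eq_zero hϖ hden
  · have hden : (ϖ.den : ℂ) ≠ 0 := by exact_mod_cast ϖ.den_ne_zero
    have e : ((2 * ϖ.den : ℕ) : ℂ) * (ϖ : ℂ) * r = (ϖ.num : ℂ) * t := by
      rw [← hr, Rat.cast_def ϖ]
      push_cast
      field_simp
    rw [e]
    exact (isIntegral_algebraMap (R := ℤ) (x := ϖ.num)).mul ht

/-! ### §5 The two clauses of F″ at an arbitrary member `V` (prime-to-`p` transfer inside
`exists_unit_mul_plusPeriod_of_irreducible` / `exists_unit_mul_minusPeriod_of_irreducible`) -/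

/-- **F″, even clause, at every level and every prime `p ≥ 5` with `E[p]` irreducible** (no additivity, no
Kosters–Pannekoek clause): for `V/ℚ` globally minimal with newform `f ∈ S₂(Γ₀(N))`, `m` prime to `N`, an even
`χ ≠ 1` mod `m`, `ϖ·Ω(V) = Ω⁺_f` and `E·Σ_a χ(a){∞,a/m}_f = r·Ω⁺_f` with `E` the Euler-depletion factor:
`s·ϖ·r` is an algebraic integer for some `p ∤ s`.  Inputs: §3, `p ∤ c₀` (`not_dvd_maninConstant_of_three_le`),
`SkinnerUrban2014.exists_unit_mul_plusPeriod_of_irreducible`. [cite: GreenbergVatsal2000, §3, Remark 3.4]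
[cite: MazurTateTeitelbaum1986, §I.8] -/
theorem even_clause (V : WeierstrassCurve ℚ) [V.IsElliptic] [V.IsGloballyMinimal] {N : ℕ} [NeZero N]
    (f : CuspForm (Gamma0 N) 2) (hf : IsNewformOf V f) (p : ℕ) [Fact p.Prime] (hp5 : 5 ≤ p)
    (hirr : V.HasIrreducibleModPGaloisRep p) {m : ℕ} [NeZero m] (hNm : IsCoprime (N : ℤ) m)
    (χ : DirichletCharacter ℂ m) (hχ : χ.Even) (hχ1 : χ ≠ 1) (ϖ : ℚ) (r : ℂ)
    (hϖ : (ϖ : ℝ) * V.realPeriodRat = plusPeriod f)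
    (hr : (∏ ℓ ∈ N.primeFactors with ¬ ℓ ^ 2 ∣ N,
        (((ℓ : ℂ) - (V.LFunction ℓ : ℂ) * χ (ℓ : ZMod m)) *
          ((ℓ : ℂ) - (V.LFunction ℓ : ℂ) * (χ (ℓ : ZMod m))⁻¹))) *
        twistedSymbolSum f χ = r * (plusPeriod f : ℂ)) :
    ∃ s : ℕ, ¬ p ∣ s ∧ IsIntegral ℤ ((s : ℂ) * ϖ * r) := by
  have hp2 : p ≠ 2 := by omega
  have hQ : coeffField f = ⊥ := hf.coeffField_eq_bot
  obtain ⟨k, hk, htss⟩ := exists_isIntegral_twistedSymbolSum_eq_of_even f hf.1 hQ hNm χ hχ hχ1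
  have hΩ : (plusPeriod f : ℂ) ≠ 0 := by exact_mod_cast (IsNewform0.plusPeriod_pos_holds hf.1 hQ).ne'
  set E : ℂ := ∏ ℓ ∈ N.primeFactors with ¬ ℓ ^ 2 ∣ N,
        (((ℓ : ℂ) - (V.LFunction ℓ : ℂ) * χ (ℓ : ZMod m)) *
          ((ℓ : ℂ) - (V.LFunction ℓ : ℂ) * (χ (ℓ : ZMod m))⁻¹)) with hE
  have hEint : IsIntegral ℤ E := isIntegral_eulerDepletion χ (fun ℓ ↦ V.LFunction ℓ) _
  -- `2 r = E k`
  have h2r : 2 * r = E * k := by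
    have h1 : r * (plusPeriod f : ℂ) = (E * k / 2) * (plusPeriod f : ℂ) := by
      rw [← hr, htss]; push_cast; ring
    have h2 := mul_right_cancel₀ hΩ h1
    rw [h2]; ring
  -- `ord_p ϖ = 0`
  have hc : ∀ (W₀ : WeierstrassCurve ℚ) [W₀.IsElliptic] [W₀.IsGloballyMinimal]
      (D₀ : ModularParametrizationData W₀ N), D₀.f = f →
      (∀ z ∈ D₀.L.lattice, ∃ w ∈ periodLattice D₀.f, z = D₀.c * w) → ¬ (p : ℤ) ∣ D₀.maninConstant :=
    fun W₀ _ _ D₀ _ hopt ↦ not_dvd_maninConstant_of_three_le W₀ D₀ hopt (by omega)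
  obtain ⟨u, hu, hΩu⟩ := SkinnerUrban2014.exists_unit_mul_plusPeriod_of_irreducible V p hp2 hirr f hf hc
  have hval : padicValRat p ϖ = 0 :=
    Rank1Residual.padicValRat_periodRatio_eq_zero_of_eq_unit_mul V p f hu hΩu ϖ hϖ
  exact exists_not_dvd_isIntegral_mul hp2 hval (hEint.mul hk) h2r

/-- **F″, odd clause, at every level and every prime `p ≥ 5` with `E[p]` irreducible**: for `V/ℚ` globally
minimal with newform `f`, `m` prime to `N`, an odd `χ` mod `m`, `ϖ·|Ω⁻(V)| = Ω⁻_f` and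
`E·Σ_a χ(a){∞,a/m}_f = r·Ω⁻_f·i`: `s·ϖ·r` is an algebraic integer for some `p ∤ s`.  Inputs: §3, `p ∤ c₀`,
`SkinnerUrban2014.exists_unit_mul_minusPeriod_of_irreducible`. [cite: GreenbergVatsal2000, §3, Remark 3.4]
[cite: MazurTateTeitelbaum1986, §I.8] -/
theorem odd_clause (V : WeierstrassCurve ℚ) [V.IsElliptic] [V.IsGloballyMinimal] {N : ℕ} [NeZero N]
    (f : CuspForm (Gamma0 N) 2) (hf : IsNewformOf V f) (p : ℕ) [Fact p.Prime] (hp5 : 5 ≤ p)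
    (hirr : V.HasIrreducibleModPGaloisRep p) {m : ℕ} [NeZero m] (hNm : IsCoprime (N : ℤ) m)
    (χ : DirichletCharacter ℂ m) (hχ : χ.Odd) (ϖ : ℚ) (r : ℂ)
    (hϖ : (ϖ : ℝ) * V.imaginaryPeriodRat = minusPeriod f)
    (hr : (∏ ℓ ∈ N.primeFactors with ¬ ℓ ^ 2 ∣ N,
        (((ℓ : ℂ) - (V.LFunction ℓ : ℂ) * χ (ℓ : ZMod m)) *
          ((ℓ : ℂ) - (V.LFunction ℓ : ℂ) * (χ (ℓ : ZMod m))⁻¹))) *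
        twistedSymbolSum f χ = r * (minusPeriod f : ℂ) * Complex.I) :
    ∃ s : ℕ, ¬ p ∣ s ∧ IsIntegral ℤ ((s : ℂ) * ϖ * r) := by
  have hp2 : p ≠ 2 := by omega
  have hQ : coeffField f = ⊥ := hf.coeffField_eq_bot
  obtain ⟨k, hk, htss⟩ := exists_isIntegral_twistedSymbolSum_eq_of_odd f hf.1 hQ hNm χ hχ
  have hΩ : (minusPeriod f : ℂ) ≠ 0 := by exact_mod_cast (IsNewform0.minusPeriod_pos_holds hf.1 hQ).ne'
  set E : ℂ := ∏ ℓ ∈ N.primeFactors with ¬ ℓ ^ 2 ∣ N,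
        (((ℓ : ℂ) - (V.LFunction ℓ : ℂ) * χ (ℓ : ZMod m)) *
          ((ℓ : ℂ) - (V.LFunction ℓ : ℂ) * (χ (ℓ : ZMod m))⁻¹)) with hE
  have hEint : IsIntegral ℤ E := isIntegral_eulerDepletion χ (fun ℓ ↦ V.LFunction ℓ) _
  -- `2 r = E k` (cancel `Ω⁻_f · i ≠ 0`)
  have h2r : 2 * r = E * k := by
    have hΩI : (minusPeriod f : ℂ) * I ≠ 0 := mul_ne_zero hΩ I_ne_zero
    have h1 : r * ((minusPeriod f : ℂ) * I) = (E * k / 2) * ((minusPeriod f : ℂ) * I) := by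
      rw [← mul_assoc, ← hr, htss]; push_cast; ring
    have h2 := mul_right_cancel₀ hΩI h1
    rw [h2]; ring
  have hc : ∀ (W₀ : WeierstrassCurve ℚ) [W₀.IsElliptic] [W₀.IsGloballyMinimal]
      (D₀ : ModularParametrizationData W₀ N), D₀.f = f →
      (∀ z ∈ D₀.L.lattice, ∃ w ∈ periodLattice D₀.f, z = D₀.c * w) → ¬ (p : ℤ) ∣ D₀.maninConstant :=
    fun W₀ _ _ D₀ _ hopt ↦ not_dvd_maninConstant_of_three_le W₀ D₀ hopt (by omega)
  obtain ⟨u, hu, hΩu⟩ := SkinnerUrban2014.exists_unit_mul_minusPeriod_of_irreducible V p hp2 hirr f hf hc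
  have hval : padicValRat p ϖ = 0 := padicValRat_minusPeriodRatio_eq_zero_of_eq_unit_mul V p f hu hΩu ϖ hϖ
  exact exists_not_dvd_isIntegral_mul hp2 hval (hEint.mul hk) h2r

end KatoNeronTwistedSymbolSum

/-! ### §6 The named fact -/

/-- **Kato's fact F″ holds** (the Literature named fact
`kato_neron_isIntegral_twistedSymbolSum_of_additive_five_le`, discharged): for `V/ℚ` globally minimal with
newform `f` at level `N`, `p ≥ 5` with `E[p]` irreducible, `m` prime to `pN`, `χ ≠ 1` mod `m` — the Euler-depleted
twisted symbol sum is Néron-integral at `p` in both parities.  The binders «`V` additive at `p`», «primitive»,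
«`p ∤ ord χ`» and the Kosters–Pannekoek clause of the fact are idle.  UDC-dependent through
`not_dvd_maninConstant_of_three_le`; audit (P†) pending; BSD is not proved by this.
[cite: Kato2004Asterisque, (8.1.3) (p. 180), Thm. 9.7 (p. 189), Thm. 6.6 (1) (p. 163)]
[cite: KimNakamura2020, Cor. 2.4] [cite: GreenbergVatsal2000, §3, Remark 3.4] [cite: Manin1972, §1.6] -/
theorem kato_neron_isIntegral_twistedSymbolSum_of_additive_five_le_holds :
    kato_neron_isIntegral_twistedSymbolSum_of_additive_five_le := by
  intro V _ _ N _ f hf p _ hp5 _ _ hirr m _ hm _ χ _ hχ1 _ ϖ r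
  have hNm : IsCoprime (N : ℤ) m :=
    Nat.isCoprime_iff_coprime.mpr (Nat.Coprime.coprime_dvd_right (Dvd.intro_left p rfl) hm).symm
  exact ⟨fun hev hϖ hr ↦ KatoNeronTwistedSymbolSum.even_clause V f hf p hp5 hirr hNm χ hev hχ1 ϖ r hϖ hr,
    fun hodd hϖ hr ↦ KatoNeronTwistedSymbolSum.odd_clause V f hf p hp5 hirr hNm χ hodd ϖ r hϖ hr⟩

end Summit.BirchSwinnertonDyer.BirchSwinnertonDyer.Theorems

end
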